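import Summits.CriticalPhenomena.CardyFormulaZ2.Theorems.CardySelfRefinementLagHandOffStairCuts
import Summits.CriticalPhenomena.CardyFormulaZ2.Theorems.CardySelfRefinementLagHandOffStairCutsArc
import Summits.CriticalPhenomena.CardyFormulaZ2.Theorems.CardySelfRefinementLagHandOffNoIdleAuxDoublePointsGen
import Literature.Probability.RandomPlanarGeometry.ExteriorULC
import Literature.Probability.RandomPlanarGeometry.ChordalCurveFamilyProofs
import HarnessLib

/-!
# `NoIdleRel (stairCuts D) c` for regular curves — crux `CardySelfRefinement.LagHandOff`
# (stmt-CriticalPhenomena-10268), line `hitting-tournament`, method step (d) of `stub_quadTransfer`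

The registered stub `stub_quadTransfer_noIdleRelStairCuts`: the third hypothesis of tournament
rigidity (`stub_tournamentRigidity`) for the target family `stairCuts D` of
`Theorems/CardySelfRefinementLagHandOffStairCuts.lean` is a DETERMINISTIC consequence of the
regularity of the curve.  For a curve `c` of `D̄` which traces no boundary arc (`NoTraceAt`),
never idles inside its past range (`NoIdleAt`) and never enters a curve-sealed pocket (no-seal, the
form T1′ of the no-re-entry regularity: at every time `u ≥ s` the point `c u` lies in the closure
of the union of those components of `D ∖ c[0,s]` whose closure meets `∂D` off `c[0,s]`), every
parameter interval `[s, t]` is an interval of constancy or contains STRICTLY the first-hitting time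
of some member of `stairCuts D`.

Proof.
1. (`…NoIdleAuxDoublePointsGen`) Non-constancy on `[s,t]`, no idling and no tracing give
   `s < p < q < t` with `c p ≠ c q` and `c[p,q] ⊆ D ∖ K`, `K = c[0,s]`: take `u ∈ (s,t)` off `K`
   (`NoIdleAt`), the last time `α < u` in `K`, a time `v₁ ∈ (α,u)` with `c v₁ ≠ c u`, and apply
   `exists_ne_forall_mem_carrier` on `(v₁, u)`.
2. A coordinate of `c` takes a rational value `x*` at some `v* ∈ [p,q]` (intermediate values), so
   `z* = c v*` lies on a closed lattice edge `E` of a rational mesh inside any prescribed ball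
   (`exists_latticeEdge_through_re/im`).
3. Let `P` be the component of `D ∖ K` containing `z*` (open).  No-seal at `(s, v*)` and openness
   of `P` give a point `q' ∈ closure P ∩ ∂D ∖ K`, hence a ball `B = B(q', r₁)` missing `K`;
   `U = P ∪ B` is open, preconnected and misses `K`; `V = B ∖ D̄` is open, nonempty (boundary
   points of a Jordan domain are limits of exterior points) and misses `E ⊆ P ⊆ D`.
4. `stub_quadTransfer_stairArcThrough` (`…StairCutsArc`) gives a rational staircase arc `L`
   with `E ⊆ L ⊆ U` and both endpoints in `V` (outside `D`).  The member
   `F = closure (component of L ∩ D containing z*)` of `stairCuts D` contains `c v*`, so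
   `hitParam F ≤ v* < t`, and `F ⊆ L ⊆ U` misses `K = c[0,s]`, so `hitParam F > s` (the curve is in
   the closed `F` at its first-hitting time).
-/

noncomputable section

open Set Metric Filter Topology
open scoped unitInterval
open Literature.Topology.PlaneTopology Literature.Probability.LatticeModels
open Literature.Probability.Percolation Literature.Probability.RandomPlanarGeometry

namespace Summit.CriticalPhenomena.CardyFormulaZ2.Cruxes.LagHandOff.HittingTournament

/-! ### A point with a rational coordinate lies on a small closed lattice edge of a rational mesh -/

/-- Distance in `ℂ` is at most the sum of the coordinate distances. -/
private theorem dist_le_coord (w z : ℂ) : dist w z ≤ |w.re - z.re| + |w.im - z.im| := by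
  rw [Complex.dist_eq]
  simpa only [Complex.sub_re, Complex.sub_im] using Complex.norm_le_abs_re_add_abs_im (w - z)

/-- A rational mesh `h = 1 / ((n + 1) x.den) ≤ 1 / (n + 1)` in which the rational `x` is a lattice
abscissa: `h · (x.num (n + 1)) = x`. -/
private theorem exists_mesh (x : ℚ) (n : ℕ) :
    ∃ (h : ℚ) (k : ℤ), 0 < h ∧ (h : ℝ) ≤ 1 / (n + 1) ∧ ((h * k : ℚ) : ℝ) = x := by
  refine ⟨1 / ((n + 1 : ℕ) * x.den : ℚ), x.num * (n + 1 : ℕ), by positivity, ?_, ?_⟩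
  · have hden : (1 : ℝ) ≤ x.den := by exact_mod_cast x.pos
    push_cast
    rw [div_le_div_iff₀ (by positivity) (by positivity), one_mul]
    nlinarith
  · have key : (1 / ((n + 1 : ℕ) * x.den : ℚ)) * (x.num * (n + 1 : ℕ) : ℤ) = x := by
      have hn : ((n : ℚ) + 1) ≠ 0 := by positivity
      push_cast
      rw [div_mul_eq_mul_div, one_mul, mul_comm (x.num : ℚ), mul_div_mul_left _ _ hn,
        Rat.num_div_den]
    exact_mod_cast congrArg (fun q : ℚ => (q : ℝ)) key

/-- **A point with rational abscissa lies on a small closed VERTICAL lattice edge of a rational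
mesh**: for `x ∈ ℚ`, `y ∈ ℝ`, `r > 0` there are a rational mesh `h > 0` and adjacent sites
`g ∼ g'` with `(x, y) ∈ [h g, h g'] ⊆ B((x, y), r)`. -/
theorem exists_latticeEdge_through_re (x : ℚ) (y : ℝ) {r : ℝ} (hr : 0 < r) :
    ∃ (h : ℚ) (g g' : Site 2), 0 < h ∧ (zdGraph 2).Adj g g' ∧
      (⟨x, y⟩ : ℂ) ∈ segment ℝ (meshPoint (h : ℝ) g) (meshPoint (h : ℝ) g') ∧
      segment ℝ (meshPoint (h : ℝ) g) (meshPoint (h : ℝ) g') ⊆ ball (⟨x, y⟩ : ℂ) r := by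
  obtain ⟨n, hn⟩ := exists_nat_one_div_lt hr
  obtain ⟨h, k, hh0, hhle, hx⟩ := exists_mesh x n
  have hhR : (0 : ℝ) < h := by exact_mod_cast hh0
  have hhr : (h : ℝ) < r := hhle.trans_lt hn
  set g : Site 2 := ![k, ⌊y / h⌋] with hg
  set g' : Site 2 := g + Pi.single 1 1 with hg'
  have hfl₁ := (le_div_iff₀ hhR).1 (Int.floor_le (y / h))
  have hfl₂ := (div_lt_iff₀ hhR).1 (Int.lt_floor_add_one (y / h))
  have hA : meshPoint (h : ℝ) g = ⟨x, h * ⌊y / h⌋⟩ :=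
    Complex.ext (by rw [← hx]; simp [hg, meshPoint_re]) (by simp [hg, meshPoint_im])
  have hg'0 : g' 0 = g 0 := by simp [hg']
  have hg'1 : g' 1 = g 1 + 1 := by simp [hg']
  have hB : meshPoint (h : ℝ) g' = ⟨x, h * ⌊y / h⌋ + h⟩ :=
    Complex.ext (by rw [meshPoint_re, hg'0, ← meshPoint_re, hA])
      (by rw [meshPoint_im, hg'1]; simp only [hg, Matrix.cons_val_one, Matrix.cons_val_zero]; push_cast; ring)
  refine ⟨h, g, g', hh0, (zdGraph_adj_iff _ _).2 ⟨1, Or.inl rfl⟩, ?_, ?_⟩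
  · rw [hA, hB, segment_eq_image']
    refine ⟨(y - h * ⌊y / h⌋) / h, ⟨div_nonneg (by linarith) hhR.le,
      (div_le_one hhR).2 (by linarith)⟩, ?_⟩
    apply Complex.ext
    · simp
    · simp only [Complex.add_im, Complex.real_smul, Complex.mul_im, Complex.ofReal_re,
        Complex.ofReal_im, Complex.sub_im, Complex.sub_re, zero_mul, add_zero]
      field_simp
      ring
  · intro w hw
    rw [hA, hB, segment_eq_image'] at hw
    obtain ⟨θ, ⟨hθ0, hθ1⟩, rfl⟩ := hw
    rw [mem_ball]
    refine (dist_le_coord _ _).trans_lt ?_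
    have e1 : ((⟨(x : ℝ), (h : ℝ) * ⌊y / h⌋⟩ : ℂ) + θ • ((⟨(x : ℝ), (h : ℝ) * ⌊y / h⌋ + h⟩ : ℂ) -
        ⟨(x : ℝ), (h : ℝ) * ⌊y / h⌋⟩)).re = x := by simp
    have e2 : ((⟨(x : ℝ), (h : ℝ) * ⌊y / h⌋⟩ : ℂ) + θ • ((⟨(x : ℝ), (h : ℝ) * ⌊y / h⌋ + h⟩ : ℂ) -
        ⟨(x : ℝ), (h : ℝ) * ⌊y / h⌋⟩)).im = h * ⌊y / h⌋ + θ * h := by simp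
    rw [e1, e2, sub_self, abs_zero, zero_add, abs_lt]
    constructor <;> nlinarith

/-- **A point with rational ordinate lies on a small closed HORIZONTAL lattice edge of a rational
mesh.** -/
theorem exists_latticeEdge_through_im (x : ℝ) (y : ℚ) {r : ℝ} (hr : 0 < r) :
    ∃ (h : ℚ) (g g' : Site 2), 0 < h ∧ (zdGraph 2).Adj g g' ∧
      (⟨x, y⟩ : ℂ) ∈ segment ℝ (meshPoint (h : ℝ) g) (meshPoint (h : ℝ) g') ∧
      segment ℝ (meshPoint (h : ℝ) g) (meshPoint (h : ℝ) g') ⊆ ball (⟨x, y⟩ : ℂ) r := by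
  obtain ⟨n, hn⟩ := exists_nat_one_div_lt hr
  obtain ⟨h, k, hh0, hhle, hy⟩ := exists_mesh y n
  have hhR : (0 : ℝ) < h := by exact_mod_cast hh0
  have hhr : (h : ℝ) < r := hhle.trans_lt hn
  set g : Site 2 := ![⌊x / h⌋, k] with hg
  set g' : Site 2 := g + Pi.single 0 1 with hg'
  have hfl₁ := (le_div_iff₀ hhR).1 (Int.floor_le (x / h))
  have hfl₂ := (div_lt_iff₀ hhR).1 (Int.lt_floor_add_one (x / h))
  have hA : meshPoint (h : ℝ) g = ⟨h * ⌊x / h⌋, y⟩ :=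
    Complex.ext (by simp [hg, meshPoint_re]) (by rw [← hy]; simp [hg, meshPoint_im])
  have hg'0 : g' 0 = g 0 + 1 := by simp [hg']
  have hg'1 : g' 1 = g 1 := by simp [hg']
  have hB : meshPoint (h : ℝ) g' = ⟨h * ⌊x / h⌋ + h, y⟩ :=
    Complex.ext (by rw [meshPoint_re, hg'0]; simp only [hg, Matrix.cons_val_zero]; push_cast; ring)
      (by rw [meshPoint_im, hg'1, ← meshPoint_im, hA])
  refine ⟨h, g, g', hh0, (zdGraph_adj_iff _ _).2 ⟨0, Or.inl rfl⟩, ?_, ?_⟩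
  · rw [hA, hB, segment_eq_image']
    refine ⟨(x - h * ⌊x / h⌋) / h, ⟨div_nonneg (by linarith) hhR.le,
      (div_le_one hhR).2 (by linarith)⟩, ?_⟩
    apply Complex.ext
    · simp only [Complex.add_re, Complex.real_smul, Complex.mul_re, Complex.ofReal_re,
        Complex.ofReal_im, Complex.sub_re, Complex.sub_im, zero_mul, sub_zero]
      field_simp
      ring
    · simp
  · intro w hw
    rw [hA, hB, segment_eq_image'] at hw
    obtain ⟨θ, ⟨hθ0, hθ1⟩, rfl⟩ := hw
    rw [mem_ball]
    refine (dist_le_coord _ _).trans_lt ?_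
    have e1 : ((⟨(h : ℝ) * ⌊x / h⌋, (y : ℝ)⟩ : ℂ) + θ • ((⟨(h : ℝ) * ⌊x / h⌋ + h, (y : ℝ)⟩ : ℂ) -
        ⟨(h : ℝ) * ⌊x / h⌋, (y : ℝ)⟩)).re = h * ⌊x / h⌋ + θ * h := by simp
    have e2 : ((⟨(h : ℝ) * ⌊x / h⌋, (y : ℝ)⟩ : ℂ) + θ • ((⟨(h : ℝ) * ⌊x / h⌋ + h, (y : ℝ)⟩ : ℂ) -
        ⟨(h : ℝ) * ⌊x / h⌋, (y : ℝ)⟩)).im = y := by simp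
    rw [e1, e2, sub_self, abs_zero, add_zero, abs_lt]
    constructor <;> nlinarith

/-- **Through a point with a rational coordinate inside an open set passes a closed lattice edge of
a rational mesh contained in the set.** -/
theorem exists_latticeEdge_through {z : ℂ} (hz : (∃ x : ℚ, z.re = x) ∨ ∃ y : ℚ, z.im = y)
    {W : Set ℂ} (hW : IsOpen W) (hzW : z ∈ W) :
    ∃ (h : ℚ) (g g' : Site 2), 0 < h ∧ (zdGraph 2).Adj g g' ∧
      z ∈ segment ℝ (meshPoint (h : ℝ) g) (meshPoint (h : ℝ) g') ∧
      segment ℝ (meshPoint (h : ℝ) g) (meshPoint (h : ℝ) g') ⊆ W := by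
  obtain ⟨r, hr, hball⟩ := Metric.isOpen_iff.1 hW z hzW
  rcases hz with ⟨x, hx⟩ | ⟨y, hy⟩
  · have ez : z = ⟨x, z.im⟩ := Complex.ext hx rfl
    obtain ⟨h, g, g', hh, hgg', hmem, hsub⟩ := exists_latticeEdge_through_re x z.im hr
    rw [← ez] at hmem hsub
    exact ⟨h, g, g', hh, hgg', hmem, hsub.trans hball⟩
  · have ez : z = ⟨z.re, y⟩ := Complex.ext rfl hy
    obtain ⟨h, g, g', hh, hgg', hmem, hsub⟩ := exists_latticeEdge_through_im z.re y hr
    rw [← ez] at hmem hsub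
    exact ⟨h, g, g', hh, hgg', hmem, hsub.trans hball⟩

/-! ### A non-degenerate bulk piece of the curve off the past, and a rational coordinate on it -/

/-- **Step 1.** A curve of `D̄` tracing no boundary arc and never idling inside its past range is,
on every parameter interval `(s, t)` where it is not constant, non-degenerate in the bulk off its
past: `s < p < q < t` with `c p ≠ c q` and `c[p, q] ⊆ D ∖ c[0, s]`. -/
theorem exists_bulk_piece_off_past (D : DobrushinDomain) {c : Curve ℂ}
    (hcl : ∀ u, c u ∈ closure D.carrier)
    (hnt : ∀ p q : I, p < q → c '' Icc p q ⊆ frontier D.carrier → (c '' Icc p q).Subsingleton)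
    (hni : ∀ s t : I, s < t → (∀ u ∈ Icc s t, c u = c s) ∨ ∃ u ∈ Ioo s t, c u ∉ c '' Icc 0 s)
    {s t : I} (hst : s < t) (hnc : ¬ ∀ u ∈ Icc s t, c u = c s) :
    ∃ p q : I, s < p ∧ p < q ∧ q < t ∧ c p ≠ c q ∧
      ∀ u : I, p ≤ u → u ≤ q → c u ∈ D.carrier ∧ c u ∉ c '' Icc 0 s := by
  set K : Set ℂ := c '' Icc 0 s with hK
  have hKc : IsCompact K := (isCompact_Icc.image c.continuous)
  obtain ⟨u, hu, huK⟩ : ∃ u ∈ Ioo s t, c u ∉ K := (hni s t hst).resolve_left hnc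
  -- the last time `α ≤ u` at which the curve is in the past range
  set Z : Set I := {v | v ≤ u ∧ c v ∈ K} with hZ
  have hZc : IsClosed Z :=
    (isClosed_le continuous_id continuous_const).inter (hKc.isClosed.preimage c.continuous)
  have hsZ : s ∈ Z := ⟨hu.1.le, ⟨s, ⟨unitInterval.nonneg', le_rfl⟩, rfl⟩⟩
  obtain ⟨α, ⟨hαu, hαK⟩, hαmax⟩ := hZc.isCompact.exists_isGreatest ⟨s, hsZ⟩
  have hαu' : α < u := lt_of_le_of_ne hαu fun h => huK (h ▸ hαK)
  have hsα : s ≤ α := hαmax hsZ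
  have hafter : ∀ v, α < v → v ≤ u → c v ∉ K := fun v h1 h2 h3 =>
    absurd (hαmax ⟨h2, h3⟩) (not_le.2 h1)
  have hne : c α ≠ c u := fun h => huK (h ▸ hαK)
  -- a time `v₁ ∈ (α, u)` with `c v₁ ≠ c u`
  have hopen : {v : I | c v ≠ c u} ∈ 𝓝 α :=
    (isOpen_ne_fun c.continuous continuous_const).mem_nhds hne
  obtain ⟨u', hαu'', hsub⟩ := exists_Ico_subset_of_mem_nhds hopen ⟨u, hαu'⟩
  obtain ⟨v₁, hαv₁, hv₁⟩ := exists_between (lt_min hαu'' hαu')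
  have hv₁u' : v₁ < u' := hv₁.trans_le (min_le_left _ _)
  have hv₁u : v₁ < u := hv₁.trans_le (min_le_right _ _)
  have hcv₁ : c v₁ ≠ c u := hsub ⟨hαv₁.le, hv₁u'⟩
  -- a non-constant bulk piece inside `(v₁, u)`
  obtain ⟨p, q, hp, hpq, hqu, hcpq, hpqD⟩ := exists_ne_forall_mem_carrier D hcl hnt hv₁u
    fun hall => hcv₁ (hall u ⟨hv₁u.le, le_rfl⟩).symm
  refine ⟨p, q, lt_of_le_of_lt hsα (hαv₁.trans hp), hpq, hqu.trans hu.2, hcpq,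
    fun w hpw hwq => ⟨hpqD w hpw hwq, hafter w (hαv₁.trans (hp.trans_le hpw))
      (hwq.trans (hqu.le))⟩⟩

/-- **Step 2.** On a non-degenerate piece `c p ≠ c q`, `p ≤ q`, some coordinate of the curve takes a
rational value (intermediate value theorem). -/
theorem exists_rat_coord (c : Curve ℂ) {p q : I} (hpq : p ≤ q) (hcpq : c p ≠ c q) :
    ∃ v : I, p ≤ v ∧ v ≤ q ∧ ((∃ x : ℚ, (c v).re = x) ∨ ∃ y : ℚ, (c v).im = y) := by
  have hpq' : (p : ℝ) ≤ q := Subtype.coe_le_coe.2 hpq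
  set f : ℝ → ℂ := fun x => c (projIcc 0 1 zero_le_one x) with hf
  have hfc : Continuous f := c.continuous.comp continuous_projIcc
  have hfp : f p = c p := by simp [hf, projIcc_val]
  have hfq : f q = c q := by simp [hf, projIcc_val]
  -- from a real parameter in `[p, q]` back to `I`
  have back : ∀ y ∈ Icc (p : ℝ) q, ∃ v : I, p ≤ v ∧ v ≤ q ∧ f y = c v := fun y hy => by
    have hyI : y ∈ Icc (0 : ℝ) 1 := ⟨p.2.1.trans hy.1, hy.2.trans q.2.2⟩
    refine ⟨⟨y, hyI⟩, Subtype.coe_le_coe.1 hy.1, Subtype.coe_le_coe.1 hy.2, ?_⟩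
    simp [hf, projIcc_of_mem _ hyI]
  have hne : (c p).re ≠ (c q).re ∨ (c p).im ≠ (c q).im := by
    by_contra hcon
    push Not at hcon
    exact hcpq (Complex.ext hcon.1 hcon.2)
  rcases hne with hre | him
  · obtain ⟨x, hx1, hx2⟩ := exists_rat_btwn (min_lt_max.2 hre)
    have hxmem : (x : ℝ) ∈ uIcc (f p).re (f q).re := by
      rw [hfp, hfq, Set.mem_uIcc]
      rcases le_total (c p).re (c q).re with hle | hle
      · rw [min_eq_left hle, max_eq_right hle] at *; exact Or.inl ⟨hx1.le, hx2.le⟩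
      · rw [min_eq_right hle, max_eq_left hle] at *; exact Or.inr ⟨hx1.le, hx2.le⟩
    obtain ⟨y, hy, hyx⟩ := intermediate_value_uIcc (f := fun y => (f y).re)
      (by fun_prop : Continuous fun y => (f y).re).continuousOn hxmem
    rw [uIcc_of_le hpq'] at hy
    obtain ⟨v, hpv, hvq, hfv⟩ := back y hy
    refine ⟨v, hpv, hvq, Or.inl ⟨x, ?_⟩⟩
    rw [← hfv]
    exact hyx
  · obtain ⟨x, hx1, hx2⟩ := exists_rat_btwn (min_lt_max.2 him)
    have hxmem : (x : ℝ) ∈ uIcc (f p).im (f q).im := by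
      rw [hfp, hfq, Set.mem_uIcc]
      rcases le_total (c p).im (c q).im with hle | hle
      · rw [min_eq_left hle, max_eq_right hle] at *; exact Or.inl ⟨hx1.le, hx2.le⟩
      · rw [min_eq_right hle, max_eq_left hle] at *; exact Or.inr ⟨hx1.le, hx2.le⟩
    obtain ⟨y, hy, hyx⟩ := intermediate_value_uIcc (f := fun y => (f y).im)
      (by fun_prop : Continuous fun y => (f y).im).continuousOn hxmem
    rw [uIcc_of_le hpq'] at hy
    obtain ⟨v, hpv, hvq, hfv⟩ := back y hy
    refine ⟨v, hpv, hvq, Or.inr ⟨x, ?_⟩⟩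
    rw [← hfv]
    exact hyx

/-! ### The stub -/

/-- **`NoIdleRel (stairCuts D) c` from regularity and no-seal (deterministic).**  For a curve `c`
of `D̄` from `a` which traces no boundary arc (`NoTraceAt`), never idles inside its past range
(`NoIdleAt`) and never enters a curve-sealed pocket (no-seal, T1′: `c u` always lies in the closure
of the union of the components of `D ∖ c[0,s]` whose closure meets `∂D` off `c[0,s]`), every
parameter interval is an interval of constancy or contains strictly inside the first-hitting time
of some staircase cross-cut `F ∈ stairCuts D`.  See the module docstring for the proof. -/
theorem stub_quadTransfer_noIdleRelStairCuts :
    ∀ (D : DobrushinDomain) (c : Curve ℂ), (∀ u, c u ∈ closure D.carrier) → c 0 = D.pt 0 →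
      (∀ s t : I, s < t → c '' Set.Icc s t ⊆ frontier D.carrier →
        (c '' Set.Icc s t).Subsingleton) →
      (∀ s t : I, s < t → (∀ u ∈ Set.Icc s t, c u = c s) ∨
        ∃ u ∈ Set.Ioo s t, c u ∉ c '' Set.Icc 0 s) →
      (∀ s u : I, s ≤ u → c u ∈ closure {z : ℂ | z ∈ D.carrier \ c '' Set.Icc 0 s ∧
        ¬ (closure (connectedComponentIn (D.carrier \ c '' Set.Icc 0 s) z) ∩
            frontier D.carrier ⊆ c '' Set.Icc 0 s)}) →
      ∀ s t : I, s < t → (∀ u ∈ Set.Icc s t, c u = c s) ∨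
        ∃ F ∈ stairCuts D, (s : ℝ) < c.hitParam F ∧ c.hitParam F < (t : ℝ) := by
  intro D c hcl _ hnt hni hseal s t hst
  by_cases hconst : ∀ u ∈ Set.Icc s t, c u = c s
  · exact Or.inl hconst
  right
  set K : Set ℂ := c '' Icc 0 s with hK
  have hKc : IsCompact K := (isCompact_Icc.image c.continuous)
  -- Step 1: a non-degenerate bulk piece off the past; Step 2: a rational coordinate on it
  obtain ⟨p, q, hsp, hpq, hqt, hcpq, hpqD⟩ := exists_bulk_piece_off_past D hcl hnt hni hst hconst
  obtain ⟨v, hpv, hvq, hrat⟩ := exists_rat_coord c hpq.le hcpq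
  obtain ⟨hzD, hzK⟩ := hpqD v hpv hvq
  -- Step 3: the component `P` of `D ∖ K` at `z* = c v`, an unsealed boundary point `q'`
  set P : Set ℂ := connectedComponentIn (D.carrier \ K) (c v) with hP
  have hDK : IsOpen (D.carrier \ K) := D.isOpen.sdiff hKc.isClosed
  have hPo : IsOpen P := hDK.connectedComponentIn
  have hzP : c v ∈ P := mem_connectedComponentIn ⟨hzD, hzK⟩
  have hPc : IsPreconnected P := isPreconnected_connectedComponentIn
  have hPsub : P ⊆ D.carrier \ K := connectedComponentIn_subset _ _
  have hsv : s ≤ v := hsp.le.trans hpv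
  have hcl' := hseal s v hsv
  obtain ⟨z₀, hz₀P, -, hz₀⟩ := (mem_closure_iff_nhds.1 hcl') P (hPo.mem_nhds hzP)
  rw [← connectedComponentIn_eq hz₀P, Set.not_subset] at hz₀
  obtain ⟨q', ⟨hq'P, hq'fr⟩, hq'K⟩ := hz₀
  -- a ball about `q'` missing `K`; the open sets `U = P ∪ B`, `V = B ∖ D̄`
  obtain ⟨r₁, hr₁, hballK⟩ := Metric.isOpen_iff.1 hKc.isClosed.isOpen_compl q' hq'K
  set B : Set ℂ := ball q' r₁ with hB
  set U : Set ℂ := P ∪ B with hU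
  have hUo : IsOpen U := hPo.union isOpen_ball
  obtain ⟨w, hwP, hwq'⟩ := Metric.mem_closure_iff.1 hq'P r₁ hr₁
  have hUc : IsPreconnected U :=
    IsPreconnected.union w hwP (by rw [hB, mem_ball, dist_comm]; exact hwq') hPc
      (convex_ball q' r₁).isPreconnected
  have hUK : ∀ z ∈ U, z ∉ K := by
    rintro z (hz | hz)
    · exact (hPsub hz).2
    · exact hballK hz
  set V : Set ℂ := B \ closure D.carrier with hV
  have hVo : IsOpen V := isOpen_ball.sdiff isClosed_closure
  have hVU : V ⊆ U := fun z hz => Or.inr hz.1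
  have hVne : V.Nonempty := by
    have hq'ext : q' ∈ closure (closure D.carrier)ᶜ :=
      D.toJordanDomain.frontier_subset_closure_exterior' hq'fr
    obtain ⟨e, he, heq'⟩ := Metric.mem_closure_iff.1 hq'ext r₁ hr₁
    exact ⟨e, mem_ball.2 (by rw [dist_comm]; exact heq'), he⟩
  -- Step 2 (continued): a closed lattice edge `E ∋ c v` of a rational mesh inside `P`
  obtain ⟨h, g, g', hh, hgg', hzE, hEP⟩ := exists_latticeEdge_through hrat hPo hzP
  have hEU : segment ℝ (meshPoint (h : ℝ) g) (meshPoint (h : ℝ) g') ⊆ U := hEP.trans subset_union_left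
  have hEV : Disjoint (segment ℝ (meshPoint (h : ℝ) g) (meshPoint (h : ℝ) g')) V :=
    Set.disjoint_left.2 fun z hz hzV => hzV.2 (subset_closure (hPsub (hEP hz)).1)
  -- Step 4: the staircase arc and the member of `stairCuts D`
  obtain ⟨L, S, a, b, hax, hLS, hLarc, haV, hbV, hEL, hLU⟩ :=
    stub_quadTransfer_stairArcThrough U V hUo hUc hVo hVU hVne h hh g g' hgg' hEU hEV
  have hzL : c v ∈ L := hEL hzE
  set F : Set ℂ := closure (connectedComponentIn (L ∩ D.carrier) (c v)) with hF
  have hFmem : F ∈ stairCuts D := by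
    refine ⟨L, S, a, b, c v, hax, hLS, hLarc, fun haD => haV.2 (subset_closure haD),
      fun hbD => hbV.2 (subset_closure hbD), ⟨hzL, hzD⟩, rfl⟩
  have hFL : F ⊆ L :=
    closure_minimal ((connectedComponentIn_subset _ _).trans inter_subset_left)
      hLarc.isCompact.isClosed
  have hzF : c v ∈ F := subset_closure (mem_connectedComponentIn ⟨hzL, hzD⟩)
  refine ⟨F, hFmem, ?_, ?_⟩
  · -- `hitParam F > s`: at its first-hitting time the curve is in `F ⊆ L ⊆ U`, which misses `K`
    by_contra hle
    push Not at hle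
    have hmem := Curve.apply_hitParam_mem (F := F) isClosed_closure (γ := c) ⟨v, hzF⟩
    have hinK : c ⟨c.hitParam F, c.hitParam_mem_Icc F⟩ ∈ K := by
      refine ⟨⟨c.hitParam F, c.hitParam_mem_Icc F⟩, ⟨unitInterval.nonneg', ?_⟩, rfl⟩
      exact Subtype.coe_le_coe.1 hle
    exact hUK _ (hLU (hFL hmem)) hinK
  · -- `hitParam F ≤ v ≤ q < t`
    have h1 : c.hitParam F ≤ v := Curve.hitParam_le hzF
    have h2 : (v : ℝ) ≤ q := Subtype.coe_le_coe.2 hvq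
    have h3 : (q : ℝ) < t := Subtype.coe_lt_coe.2 hqt
    linarith

end Summit.CriticalPhenomena.CardyFormulaZ2.Cruxes.LagHandOff.HittingTournament

end
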